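import Summits.HodgeConjecture.HodgeConjecture.Theorems.TropicalKugaSatakeCayleyDefs
import Summits.HodgeConjecture.HodgeConjecture.Theorems.TropicalKugaSatakeCayleyEffectiveCayleyNonRealizabilityRationalFormalization
import HarnessLib

/-!
# Crux `EffectiveCayleyNonRealizability` (stmt-HodgeConjecture-18569), line `formal_rational`:
# the registered stubs 1 and 2 stated LITERALLY

With the line's devices `ksMatrixPoly` / `evalCell` / `evalChain` available in Theorems
(`TropicalKugaSatakeCayleyDefs.lean`, same bodies as the skeleton-local ones of
`Cruxes/EffectiveCayleyNonRealizability/Lines/formal_rational.lean`), the registered signatures of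
`stub_rationalFormalization` and `stub_identityPrinciple` are stated verbatim and closed by the
theorems `rationalFormalization` (rational formalisation of Kontsevich's formal cycle) and
`identityPrinciple` (identity principle by injective base change at a generic parameter) of this
namespace, whose statements are the same signatures with the devices unfolded (definitional
unfolding). No new mathematics; no definition, no sorry.
References: [Zharkov2020TropicalWeil] I. Zharkov, Tropical abelian varieties, Weil classes and the
Hodge conjecture, arXiv:2002.02347, p. 3.
-/

noncomputable section

-- `Summit.HodgeConjecture.HodgeConjecture.…` is the mandated namespace (single-conjunct summit).
set_option linter.dupNamespace false

namespace Summit.HodgeConjecture.HodgeConjecture.Theorems.EffectiveCayleyNonRealizability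

open Literature.AlgebraicGeometry.Tropical Literature.AlgebraicGeometry.Tropical.TropicalTorus
open Summit.HodgeConjecture.HodgeConjecture.Theorems.TropicalKugaSatakeCayley

/-- **Registered stub `stub_rationalFormalization`** (crux `EffectiveCayleyNonRealizability`,
stmt-HodgeConjecture-18569, line `formal_rational`), verbatim: open-effective realisability of the
period class `M` on `U` gives an affine-linear formal chain over `ℚ[t₀,…,t₄]` evaluating, on a
non-empty open `V ⊆ U`, to effective tropical cycles of `ℝ⁸ / B_t ℤ⁸` with period class `M`.
Proof: `rationalFormalization`. [cite: Zharkov2020TropicalWeil, p. 3] -/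
theorem stub_rationalFormalization :
    ∀ U : Set (Fin 5 → ℝ), IsOpen U → U.Nonempty → U ⊆ ksPosCone →
      ∀ M : Matrix (Sub 8 2) (Sub 8 2) ℝ,
        (∀ t ∈ U, ∃ Z : Chain ℝ 8 2, Z.IsCycle (ksMatrix t) ∧ Z.Effective ∧
          compound 2 (ksMatrix t)⁻¹ * Z.classOf = M) →
        ∃ 𝒵 : Chain (MvPolynomial (Fin 5) ℚ) 8 2, 𝒵.IsAffineLinear ∧
          ∃ V : Set (Fin 5 → ℝ), IsOpen V ∧ V.Nonempty ∧ V ⊆ U ∧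
            ∀ t ∈ V, (evalChain t 𝒵).IsCycle (ksMatrix t) ∧ (evalChain t 𝒵).Effective ∧
              compound 2 (ksMatrix t)⁻¹ * (evalChain t 𝒵).classOf = M :=
  rationalFormalization

/-- **Registered stub `stub_identityPrinciple`** (crux `EffectiveCayleyNonRealizability`,
stmt-HodgeConjecture-18569, line `formal_rational`), verbatim: for an affine-linear formal chain
whose evaluation at every `t` of a non-empty open `V ⊆ ksPosCone` is a tropical cycle of
`ℝ⁸ / B_t ℤ⁸` with period class `M`: it is formally a cycle (w.r.t. `ksMatrixPoly`), `M` is rational,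
and `V` contains a rational parameter. Proof: `identityPrinciple`.
[cite: Zharkov2020TropicalWeil, p. 3] -/
theorem stub_identityPrinciple :
    ∀ 𝒵 : Chain (MvPolynomial (Fin 5) ℚ) 8 2, 𝒵.IsAffineLinear →
      ∀ V : Set (Fin 5 → ℝ), IsOpen V → V.Nonempty → V ⊆ ksPosCone →
        ∀ M : Matrix (Sub 8 2) (Sub 8 2) ℝ,
          (∀ t ∈ V, (evalChain t 𝒵).IsCycle (ksMatrix t) ∧
            compound 2 (ksMatrix t)⁻¹ * (evalChain t 𝒵).classOf = M) →
          𝒵.IsCycle ksMatrixPoly ∧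
            (∃ Mq : Matrix (Sub 8 2) (Sub 8 2) ℚ, M = Mq.map (algebraMap ℚ ℝ)) ∧
            ∃ q : Fin 5 → ℚ, (fun i => (q i : ℝ)) ∈ V :=
  identityPrinciple

end Summit.HodgeConjecture.HodgeConjecture.Theorems.EffectiveCayleyNonRealizability

end
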